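import Summits.BirchSwinnertonDyer.BirchSwinnertonDyer.Theorems.SignedLowerHalvesSmallImageLowerHalfBothSignsRttD2J2DeltaCoh
import Literature.NumberTheory.GaloisRepresentations.ContinuousCohomologyConnectingNaturality
import HarnessLib

/-!
# Route `SignedLowerHalves`, crux L `SmallImageLowerHalfBothSigns` (stmt-BirchSwinnertonDyer-23599), line `rtt_w3` v16/v17 — stub A INPUT (4′) «hTF»
# (`𝐇¹(𝒪_K[1/p𝔣], Λ_𝒪(θ*)(1))` has no `T₂`-torsion), brick (TF-a): THE DEGREE-(0,1) DESCENT IN THE PERMUTATION MODEL —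
# an `R_c`-invariant class of `H¹(G, Maps(G ⧸ V', M))` pushed down to `Maps(G ⧸ V, M)` is PULLED BACK from `Maps(G ⧸ U, M)` as soon as the
# `H⁰`-norm `Maps(G ⧸ U', M)^G —Σ→ Maps(G ⧸ U, M)^G` vanishes

INPUTS hand `bsd-inputs-honda-p1` g25 under LEAD `cruxlead-stmt-BirchSwinnertonDyer-23599` g11/g12 (v16 KEY: the registered INPUT stub `stub_frameTF_ns`, consumed by
`SmallImageRttCharRoadFrame₂.stub_charRoadFrame_ns_of₂`, p-file `…RttCharRoadFrame2.lean`). Generic continuous cohomology (no number theory): `G` compact, `ρ` a FINITE discrete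
`G`-module `M`, normal open subgroups `V' ≤ V ≤ U`, `V' ≤ U' ≤ U` with finite quotients, an element `c ∈ U'` such that the fibres of `G ⧸ V' → G ⧸ U'` and of
`G ⧸ V → G ⧸ U` are `⟨c̄⟩`-orbits (`hgen'`, `hgen`; in the `ℤ_p²`-tower: `V = Gal(K̄/K̃_m)`, `U = Gal(K̄/K^{(1)}_m)` the `κ₁`-line layer, `c = γ₂`). This is the `i = 0 → 1`
companion of honda g24's `i = 1 → 2` descent (bricks (δ-a)–(δ-f), `…RttD2J2Delta*.lean`), read through the TWO short exact sequences cut out of the four-term sequence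
`0 → Maps(G ⧸ U, M) —π*→ Maps(G ⧸ V, M) —(R_c−1)→ Maps(G ⧸ V, M) —Σ→ Maps(G ⧸ U, M) → 0` (the finite-level shadow of `0 → Λ₂(T) —(γ₂−1)→ Λ₂(T) → Λ₁(T) → 0`):
* §1 ★ `isSES_coindFinRes_rTransSubToKer` — (A) `0 → Maps(G ⧸ U, M) —π*→ Maps(G ⧸ V, M) —(R_c − 1)'→ ker Σ → 0` is a short exact sequence (`ker (R_c − 1) = range π*`,
  `range (R_c − 1) = ker Σ`, bricks (δ-a)/(δ-b2)); (B) `0 → ker Σ → Maps(G ⧸ V, M) —Σ→ Maps(G ⧸ U, M) → 0` is g24's `isSES_kerIncl_coindFinSum`;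
* §2 `cohomologyMap_kerIncl_rTransSubToKer_eq_zero` — for an `R_c`-INVARIANT class `y`, `H¹(ι) (H¹((R_c − 1)') y) = H¹(R_c) y − y = 0`, so by (B) `H¹((R_c − 1)') y = δ₀(s)` for an
  invariant `s ∈ Maps(G ⧸ U, M)^G = H⁰(U, M)`; naturality of `δ₀` along the level change `(Σ_ker, Σ_{V'→V}, Σ_{U'→U})` (tree `IsSES.cohomologyMap_δ₀`) turns the deeper
  `s'` into its `H⁰`-NORM `Σ_{U'→U} s'`;
* §3 ★★ `exists_coindFinRes_eq_coindFinSum_of_rTransHom_eq` — if that `H⁰`-norm vanishes on invariants (`hH0`, the finite-level shadow of `H⁰_Iw = 0` along the `κ₁`-line), then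
  for every `R_c`-invariant `y' ∈ H¹(G, Maps(G ⧸ V', M))` the class `Σ_{V'→V} y'` is killed by `H¹((R_c − 1)')`, hence by (A) is `π*_{U→V} w`; ★★ `coindFinSum_coindFinSum_eq_zero_of_rTransHom_eq`
  — consequently `Σ_{V→V₀} (Σ_{V'→V} y') = 0` whenever `[V₀ ⊓ U : V] • M = 0` (brick (δ-a) `coindFinSum_coindFinRes_eq_zero_of_index_smul_eq_zero`).
Under Shapiro (bricks (δ-d2), (TF-b)/(TF-c)) this is: a `conj_{γ₂}`-fixed norm-compatible family in `lim← H¹(G_S(K̃_n), X_k)` is zero, i.e. `𝐇¹[T₂] = 0`.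
THEOREMS ONLY (`--supports stmt-BirchSwinnertonDyer-23599` helper); closes nothing; crux L, crux M, E2 and BSD remain OPEN and are proved for NO curve by any of this.
References: [SerreGaloisCohomology1997] I §2.2–§2.5; [NeukirchSchmidtWingberg2008] (1.3.2)–(1.3.3), I §5 Cor. (1.5.7), I §6 Prop. (1.6.4); [PerrinRiou1994Invent] §1.3 (descent of Iwasawa
cohomology: `H¹_Iw[γ − 1]` is a quotient of `H⁰_Iw`); [SerreLocalFields1979] VII §5–§7.
-/

set_option autoImplicit false
-- the Theorems namespace of this sub repeats the summit name by design (D-0017 nested layout)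
set_option linter.dupNamespace false

noncomputable section

open CategoryTheory
open scoped Classical

universe u

namespace Summit.BirchSwinnertonDyer.BirchSwinnertonDyer.Theorems.SmallImageRttD2TF

open Literature.NumberTheory.GaloisRepresentations
open Summit.BirchSwinnertonDyer.BirchSwinnertonDyer.Theorems.SmallImageRttD2J2Delta

variable {G : Type u} [Group G] [TopologicalSpace G] [IsTopologicalGroup G] [CompactSpace G]
variable {M : Type u} [AddCommGroup M] [TopologicalSpace M] [DiscreteTopology M] (ρ : ContinuousRep G ℤ M)

/-! ## §1 The short exact sequence (A) `0 → Maps(G ⧸ U, M) —π*→ Maps(G ⧸ V, M) —(R_c − 1)'→ ker Σ → 0` -/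

section SESA

variable {U V : Subgroup G} (h : V ≤ U) (hU : IsOpen (U : Set G)) (hV : IsOpen (V : Set G)) [V.Normal] {c : G}
  [Fintype (G ⧸ V)] [Fintype (G ⧸ U)]

omit [IsTopologicalGroup G] [CompactSpace G] [Fintype (G ⧸ U)] [V.Normal] [Fintype (G ⧸ V)] in
/-- The pull-back `π* : Maps(G ⧸ U, M) → Maps(G ⧸ V, M)` is injective (`G ⧸ V → G ⧸ U` is onto). [cite: NeukirchSchmidtWingberg2008, I §6 (induced modules)] -/
theorem coindFinRes_injective : Function.Injective (coindFinRes ρ.toTopRep h).hom := fun f f' hff' => funext fun x => by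
  induction x using QuotientGroup.induction_on with
  | H a =>
    have := congrFun hff' (a : G ⧸ V)
    rwa [coindFinRes_apply, coindFinRes_apply, Subgroup.quotientMapOfLE_apply_mk] at this

/-- ★ **(A) `0 → Maps(G ⧸ U, M) —π*→ Maps(G ⧸ V, M) —(R_c − 1)'→ ker Σ_{V→U} → 0` is a short exact sequence of discrete `G`-modules** for FINITE `M`, `c ∈ U` and
`⟨c̄⟩`-orbit fibres: `(R_c − 1) ∘ π* = 0` and `ker (R_c − 1) = range π*` (brick (δ-a)), `range (R_c − 1) = ker Σ` (brick (δ-b2), the counting form of `Ĥ⁻¹(⟨c̄⟩, Ind) = 0`).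
Its long exact sequence contains `H¹(G, Maps(G ⧸ U, M)) —π*→ H¹(G, Maps(G ⧸ V, M)) —(R_c − 1)'→ H¹(G, ker Σ)`. [cite: SerreGaloisCohomology1997, I §2.2] [cite: Brown1982, VI §3] -/
theorem isSES_coindFinRes_rTransSubToKer [Finite M] (hc : c ∈ U)
    (hgen : ∀ y y' : G ⧸ V, Subgroup.quotientMapOfLE h y = Subgroup.quotientMapOfLE h y' → ∃ j : ℕ, y' = y * (c : G ⧸ V) ^ j) :
    IsSES (ρ₁ := ρ.coindOpen U hU) (ρ₂ := ρ.coindOpen V hV) (ρ₃ := kerRep ρ h hV)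
      (coindFinRes ρ.toTopRep h) (rTransSubToKer ρ h hV c hc) where
  comp_eq_zero := by
    ext f x
    have h0 : rTransSub ρ c ((coindFinRes ρ.toTopRep h).hom f) = 0 := by
      rw [rTransSub_apply, rTransHom_coindFinRes_of_mem ρ.toTopRep h hc f, sub_self]
      rfl
    exact congrFun h0 x
  injective := coindFinRes_injective ρ h
  exact_mid := fun φ hφ => by
    have h1 : rTransSub ρ c φ = 0 := congrArg Subtype.val hφ
    have hφ' : (rTransHom ρ.toTopRep V (c : G ⧸ V)).hom φ = φ := by
      rw [rTransSub_apply] at h1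
      exact sub_eq_zero.mp h1
    exact exists_coindFinRes_eq_of_rTransHom_eq ρ.toTopRep h hgen φ hφ'
  surjective := fun ψ => by
    obtain ⟨φ, hφ⟩ := exists_rTransSub_eq ρ h c hc hgen ψ
    exact ⟨φ, Subtype.ext hφ⟩

omit [Fintype (G ⧸ U)] in
/-- **`H¹(ι) ∘ H¹((R_c − 1)') = H¹(R_c) − id`** on `H¹(G, Maps(G ⧸ V, M))` (`ι ∘ (R_c − 1)' + 𝟙 = R_c` pointwise; `Hⁿ` is additive in the morphism), in vanishing form: an
`R_c`-INVARIANT class is killed by `H¹(ι) ∘ H¹((R_c − 1)')`. [cite: SerreGaloisCohomology1997, I §2.2] [cite: SerreLocalFields1979, VII §5] -/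
theorem cohomologyMap_kerIncl_rTransSubToKer_eq_zero (hc : c ∈ U) (n : ℕ) (y : continuousCohomology n (coindFin.{0, u} ρ.toTopRep V))
    (hy : cohomologyMap (rTransHom ρ.toTopRep V (c : G ⧸ V)) n y = y) :
    cohomologyMap (kerIncl ρ h hV) n (cohomologyMap (rTransSubToKer ρ h hV c hc) n y) = 0 := by
  have hcomp := cohomologyMap_comp_apply_of_eq (rTransSubToKer ρ h hV c hc) (kerIncl ρ h hV) (rTransSubToKer ρ h hV c hc ≫ kerIncl ρ h hV)
    (fun _ => rfl) n y
  have hsum := cohomologyMap_comp_apply_of_sum (𝟙 (coindFin.{0, u} ρ.toTopRep V)) (rTransHom ρ.toTopRep V (c : G ⧸ V)) (Finset.univ : Finset Bool)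
    (fun b => if b then rTransSubToKer ρ h hV c hc ≫ kerIncl ρ h hV else 𝟙 (coindFin.{0, u} ρ.toTopRep V)) (fun φ => by
      rw [Fintype.sum_bool, if_pos rfl, if_neg Bool.false_ne_true]
      change (rTransHom ρ.toTopRep V (c : G ⧸ V)).hom φ = ((rTransHom ρ.toTopRep V (c : G ⧸ V)).hom φ - φ) + φ
      rw [sub_add_cancel]) n y
  rw [cohomologyMap_id_apply, hy, Fintype.sum_bool, if_pos rfl, if_neg Bool.false_ne_true, cohomologyMap_id_apply] at hsum
  rw [hcomp]
  -- `y = H((R_c − 1)' ≫ ι) y + y`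
  have := hsum
  rw [eq_comm, add_eq_right] at this
  exact this

end SESA

/-! ## §2 The level change `(V', U') → (V, U)` and the `H⁰`-norm -/

section Descent

variable {V' V U' U : Subgroup G} (hV'V : V' ≤ V) (hV'U' : V' ≤ U') (hVU : V ≤ U) (hU'U : U' ≤ U)
  (hV' : IsOpen (V' : Set G)) (hV : IsOpen (V : Set G)) (hU' : IsOpen (U' : Set G)) (hU : IsOpen (U : Set G))
  [V'.Normal] [V.Normal] [Fintype (G ⧸ V')] [Fintype (G ⧸ V)] [Fintype (G ⧸ U')] [Fintype (G ⧸ U)] {c : G}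

omit [Fintype (G ⧸ U')] [Fintype (G ⧸ U)] in
/-- **The two routes `H¹(Maps(G ⧸ V', M)) → H¹(ker Σ_{V→U})` agree**: `H¹(Σ_ker) ∘ H¹((R_c − 1)'_{V'}) = H¹((R_c − 1)'_V) ∘ H¹(Σ_{V'→V})` (right translations commute with
fibre sums, brick (δ-a)). [cite: SerreLocalFields1979, VII §5] [cite: NeukirchSchmidtWingberg2008, (1.3.3)] -/
theorem cohomologyMap_kerMapSum_rTransSubToKer (hcU' : c ∈ U') (hcU : c ∈ U) (n : ℕ) (y' : continuousCohomology n (coindFin.{0, u} ρ.toTopRep V')) :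
    cohomologyMap (kerMapSum ρ hVU hV'U' hV'V hU'U hV hV') n (cohomologyMap (rTransSubToKer ρ hV'U' hV' c hcU') n y') =
      cohomologyMap (rTransSubToKer ρ hVU hV c hcU) n (cohomologyMap (coindFinSum ρ.toTopRep hV'V) n y') := by
  rw [cohomologyMap_comp_apply_of_eq (coindFinSum ρ.toTopRep hV'V) (rTransSubToKer ρ hVU hV c hcU)
    (coindFinSum ρ.toTopRep hV'V ≫ rTransSubToKer ρ hVU hV c hcU) (fun _ => rfl) n y']
  refine cohomologyMap_comp_apply_of_eq _ _ _ (fun φ => Subtype.ext ?_) n y'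
  change (coindFinSum ρ.toTopRep hV'V).hom (rTransSub ρ c φ) = rTransSub ρ c ((coindFinSum ρ.toTopRep hV'V).hom φ)
  rw [rTransSub_apply, rTransSub_apply, map_sub, coindFinSum_rTransHom]

omit [V'.Normal] [V.Normal] in
include hU in
/-- **Naturality of `δ₀` along the level change**, vanishing form: for the morphism `(Σ_ker, Σ_{V'→V}, Σ_{U'→U})` from the sequence (B') at `(V', U')` to (B) at `(V, U)`,
`H¹(Σ_ker) (δ₀' s') = δ₀ (Σ_{U'→U} s')` (tree `IsSES.cohomologyMap_δ₀`) — and on `G`-invariants `Σ_{U'→U}` is the `H⁰`-NORM `H⁰(U', M) → H⁰(U, M)`; so `H¹(Σ_ker) (δ₀' s') = 0`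
as soon as that norm kills `s'`. [cite: SerreGaloisCohomology1997, I §2.2] [cite: NeukirchSchmidtWingberg2008, (1.3.3)] -/
theorem cohomologyMap_kerMapSum_δ₀_eq_zero (s' : (ρ.coindOpen U' hU').toTopRep.ρ.invariants) (hs : (coindFinSum ρ.toTopRep hU'U).hom (s' : G ⧸ U' → M) = 0) :
    cohomologyMap (kerMapSum ρ hVU hV'U' hV'V hU'U hV hV') 1 ((isSES_kerIncl_coindFinSum ρ hV'U' hV' hU').δ₀ s') = 0 := by
  have hsq₂ : ∀ y : (ρ.coindOpen V' hV').toTopRep, (coindFinSum ρ.toTopRep hU'U).hom ((coindFinSum ρ.toTopRep hV'U').hom y) =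
      (coindFinSum ρ.toTopRep hVU).hom ((coindFinSum ρ.toTopRep hV'V).hom y) := fun y => by
    rw [coindFinSum_coindFinSum, coindFinSum_coindFinSum]
  rw [IsSES.cohomologyMap_δ₀ (φ₁ := kerMapSum ρ hVU hV'U' hV'V hU'U hV hV') (φ₂ := coindFinSum ρ.toTopRep hV'V) (φ₃ := coindFinSum ρ.toTopRep hU'U)
    (isSES_kerIncl_coindFinSum ρ hV'U' hV' hU') (isSES_kerIncl_coindFinSum ρ hVU hV hU) (fun _ => rfl) hsq₂ s']
  have hv : ∀ v : (ρ.coindOpen U hU).toTopRep.ρ.invariants, (v : G ⧸ U → M) = 0 → (isSES_kerIncl_coindFinSum ρ hVU hV hU).δ₀ v = 0 := fun v hv => by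
    rw [show v = 0 from Subtype.ext hv, map_zero]
  exact hv _ hs

/-! ## §3 The descent vanishing -/

include hV'U' hV' hV hU' hU in
/-- ★★ **DEGREE-(0,1) DESCENT.** If the `H⁰`-norm `Σ_{U'→U}` kills the `G`-invariants of `Maps(G ⧸ U', M)` (`hH0` — in the `ℤ_p²`-tower: the norm
`H⁰(K^{(1)}_{m'}, X_k) → H⁰(K^{(1)}_m, X_k)` vanishes for `m' ≫ m`, the finite-level shadow of `H⁰_Iw(K^{(1)}_∞, T) = 0`), then for every `R_c`-INVARIANT class
`y' ∈ H¹(G, Maps(G ⧸ V', M))` the pushed-down class `Σ_{V'→V} y'` is pulled back from `G ⧸ U`: `Σ_{V'→V} y' = π*_{U→V} w`. Proof: `H¹((R_c−1)') y' = δ₀'(s')` (§1 + exactness of (B') at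
`H¹(ker Σ')`), push down by `Σ_ker` (§2): `H¹((R_c−1)') (Σ_{V'→V} y') = δ₀(Σ_{U'→U} s') = δ₀(0) = 0`, then exactness of (A) at `H¹(Maps(G ⧸ V, M))`.
[cite: PerrinRiou1994Invent, §1.3] [cite: SerreGaloisCohomology1997, I §2.2] [cite: NeukirchSchmidtWingberg2008, (1.3.2)–(1.3.3), I §6 Prop. (1.6.4)] -/
theorem exists_coindFinRes_eq_coindFinSum_of_rTransHom_eq [Finite M] (hcU' : c ∈ U')
    (hgen : ∀ y y' : G ⧸ V, Subgroup.quotientMapOfLE hVU y = Subgroup.quotientMapOfLE hVU y' → ∃ j : ℕ, y' = y * (c : G ⧸ V) ^ j)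
    (hH0 : ∀ s : G ⧸ U' → M, s ∈ (ρ.coindOpen U' hU').toTopRep.ρ.invariants → (coindFinSum ρ.toTopRep hU'U).hom s = 0)
    (y' : continuousCohomology 1 (coindFin.{0, u} ρ.toTopRep V'))
    (hy' : cohomologyMap (rTransHom ρ.toTopRep V' (c : G ⧸ V')) 1 y' = y') :
    ∃ w : continuousCohomology 1 (coindFin.{0, u} ρ.toTopRep U),
      cohomologyMap (coindFinRes ρ.toTopRep hVU) 1 w = cohomologyMap (coindFinSum ρ.toTopRep hV'V) 1 y' := by
  have hcU : c ∈ U := hU'U hcU'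
  -- (1) `H¹((R_c − 1)'_{V'}) y' = δ₀'(s')`
  obtain ⟨s', hs'⟩ := (isSES_kerIncl_coindFinSum ρ hV'U' hV' hU').exists_δ₀_eq_of_map_one_eq_zero _
    (cohomologyMap_kerIncl_rTransSubToKer_eq_zero ρ hV'U' hV' hcU' 1 y' hy')
  -- (2) push down: `H¹((R_c − 1)'_V) (Σ y') = H¹(Σ_ker) (δ₀' s') = δ₀ (Σ_{U'→U} s') = 0`
  have hzero : cohomologyMap (rTransSubToKer ρ hVU hV c hcU) 1 (cohomologyMap (coindFinSum ρ.toTopRep hV'V) 1 y') = 0 := by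
    rw [← cohomologyMap_kerMapSum_rTransSubToKer ρ hV'V hV'U' hVU hU'U hV' hV hcU' hcU 1 y', ← hs']
    exact cohomologyMap_kerMapSum_δ₀_eq_zero ρ hV'V hV'U' hVU hU'U hV' hV hU' hU s' (hH0 _ s'.2)
  -- (3) exactness of (A) at `H¹(Maps(G ⧸ V, M))`
  exact (isSES_coindFinRes_rTransSubToKer ρ hVU hU hV hcU hgen).exists_map_one_eq_of_map_one_eq_zero _ hzero

include hV'U' hV' hV hU' hU in
/-- ★★ **VANISHING two levels down**: under the hypotheses of `exists_coindFinRes_eq_coindFinSum_of_rTransHom_eq` and `[V₀ ⊓ U : V] • M = 0` (`hidx`; in the tower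
`[V̄_n ⊓ Ū_m : V̄_m] = p^{m−n} ≥ p^k`), `Σ_{V→V₀} (Σ_{V'→V} y') = 0` for every `R_c`-invariant `y' ∈ H¹(G, Maps(G ⧸ V', M))` (`Σ_{V→V₀} ∘ π*_{U→V} = 0`, brick (δ-a)).
[cite: PerrinRiou1994Invent, §1.3] [cite: NeukirchSchmidtWingberg2008, I §5 Cor. (1.5.7)] -/
theorem coindFinSum_coindFinSum_eq_zero_of_rTransHom_eq [Finite M] {V₀ : Subgroup G} (hVV₀ : V ≤ V₀) [Fintype (G ⧸ (V₀ ⊓ U))] (hcU' : c ∈ U')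
    (hgen : ∀ y y' : G ⧸ V, Subgroup.quotientMapOfLE hVU y = Subgroup.quotientMapOfLE hVU y' → ∃ j : ℕ, y' = y * (c : G ⧸ V) ^ j)
    (hH0 : ∀ s : G ⧸ U' → M, s ∈ (ρ.coindOpen U' hU').toTopRep.ρ.invariants → (coindFinSum ρ.toTopRep hU'U).hom s = 0)
    (hidx : ∀ x : M, (V.subgroupOf (V₀ ⊓ U)).index • x = 0)
    (y' : continuousCohomology 1 (coindFin.{0, u} ρ.toTopRep V'))
    (hy' : cohomologyMap (rTransHom ρ.toTopRep V' (c : G ⧸ V')) 1 y' = y') :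
    cohomologyMap (coindFinSum ρ.toTopRep hVV₀) 1 (cohomologyMap (coindFinSum ρ.toTopRep hV'V) 1 y') = 0 := by
  obtain ⟨w, hw⟩ := exists_coindFinRes_eq_coindFinSum_of_rTransHom_eq ρ hV'V hV'U' hVU hU'U hV' hV hU' hU hcU' hgen hH0 y' hy'
  rw [← hw]
  exact cohomologyMap_comp_apply_of_zero _ _
    (coindFinSum_coindFinRes_eq_zero_of_index_smul_eq_zero (X := ρ.toTopRep) (le_inf hVV₀ hVU) inf_le_left inf_le_right hidx) 1 w

end Descent

/-! ## §4 The `H⁰`-norm along a cyclic `p`-power fibre vanishes on finite `p^k`-torsion coefficients -/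

section HZero

/-- **Periodic block sums**: if `v` is `d`-periodic under `f` then `Σ_{i<dr} fⁱ(v) = r • Σ_{i<d} fⁱ(v)`. [folklore] -/
theorem sum_range_mul_iterate_eq_smul {B : Type*} [AddCommMonoid B] (f : B → B) (v : B) {d : ℕ} (hd : Function.IsPeriodicPt f d v) (r : ℕ) :
    ∑ i ∈ Finset.range (d * r), f^[i] v = r • ∑ i ∈ Finset.range d, f^[i] v := by
  induction r with
  | zero => simp
  | succ r ih =>
    rw [Nat.mul_succ, Finset.sum_range_add, ih, succ_nsmul]
    congr 1
    refine Finset.sum_congr rfl fun i _ => ?_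
    rw [add_comm, Function.iterate_add_apply, (hd.mul_const r).eq]

/-- **Orbit sums over a `p`-power period vanish on finite `p^k`-torsion**: for `v` with `f^{p^e}(v) = v` in a finite additive group `B` with `p^k B = 0` and `#B ≤ p^t`,
`t + k ≤ e`, the sum `Σ_{i<p^e} fⁱ(v)` is `p^{e−j} •` (one minimal period, `p^j = ` the minimal period `≤ #B ≤ p^t`), hence `0`. In the `ℤ_p`-tower this is the vanishing of
the norm `H⁰(K_{m'}, X_k) → H⁰(K_m, X_k)` for `m' ≥ m + t + k` — the finite-level shadow of `H⁰_Iw(K_∞, T) = 0`. [cite: PerrinRiou1994Invent, §1.3] [cite: Washington1997, §13.3] -/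
theorem sum_range_iterate_eq_zero {B : Type*} [AddCommMonoid B] [Finite B] {p k t e : ℕ} (hp : p.Prime)
    (htor : ∀ w : B, p ^ k • w = 0) (hB : Nat.card B ≤ p ^ t) (he : t + k ≤ e)
    (f : B → B) (v : B) (hv : Function.IsPeriodicPt f (p ^ e) v) :
    ∑ i ∈ Finset.range (p ^ e), f^[i] v = 0 := by
  haveI := Fintype.ofFinite B
  obtain ⟨j, hj, hd⟩ := (Nat.dvd_prime_pow hp).1 hv.minimalPeriod_dvd
  have hjt : j ≤ t := by
    have h1 : p ^ j ≤ p ^ t :=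
      calc p ^ j = Function.minimalPeriod f v := hd.symm
        _ ≤ Fintype.card B := Function.minimalPeriod_le_card
        _ = Nat.card B := Nat.card_eq_fintype_card.symm
        _ ≤ p ^ t := hB
    exact (Nat.pow_le_pow_iff_right hp.one_lt).1 h1
  have hsplit : p ^ e = p ^ j * p ^ (e - j) := by rw [← pow_add, Nat.add_sub_cancel' hj]
  have hper : Function.IsPeriodicPt f (p ^ j) v := hd ▸ Function.isPeriodicPt_minimalPeriod f v
  rw [hsplit, sum_range_mul_iterate_eq_smul f v hper (p ^ (e - j))]
  have hk : p ^ (e - j) = p ^ (e - j - k) * p ^ k := by rw [← pow_add]; congr 1; omega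
  rw [hk, ← smul_smul, htor, smul_zero]

variable {U U' : Subgroup G} (hU'U : U' ≤ U) (hU : IsOpen (U : Set G)) (hU' : IsOpen (U' : Set G))

omit [TopologicalSpace G] [IsTopologicalGroup G] [CompactSpace G] in
/-- `g • x̄ = (g x)‾` in `G ⧸ N`. [folklore] -/
theorem smul_mk_eq (N : Subgroup G) (g x : G) : g • ((x : G) : G ⧸ N) = ((g * x : G) : G ⧸ N) := by
  rw [MulAction.Quotient.smul_mk, smul_eq_mul]

/-- **Invariant functions in the permutation model**: `s ∈ Maps(G ⧸ U', M)^G` satisfies `s(g y) = g · s(y)` (so `s` is determined by `s(1) ∈ M^{U'}`: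
`Maps(G ⧸ U', M)^G = H⁰(U', M)`). [cite: SerreLocalFields1979, VII §5] [cite: NeukirchSchmidtWingberg2008, I §6 Prop. (1.6.4)] -/
theorem apply_smul_of_mem_invariants {s : G ⧸ U' → M} (hs : s ∈ (ρ.coindOpen U' hU').toTopRep.ρ.invariants) (g : G) (y : G ⧸ U') :
    s (g • y) = ρ g (s y) := by
  have h := congrFun ((ContRepresentation.mem_invariants _).1 hs g) (g • y)
  change ρ g (s (g⁻¹ • (g • y))) = s (g • y) at h
  rw [inv_smul_smul] at h
  exact h.symm

/-- The value of an invariant function at the unit coset is fixed by `U'`: `s(1) ∈ M^{U'}`. [cite: SerreLocalFields1979, VII §5] -/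
theorem apply_one_mem_of_mem_invariants [U'.Normal] {s : G ⧸ U' → M} (hs : s ∈ (ρ.coindOpen U' hU').toTopRep.ρ.invariants) {u : G} (hu : u ∈ U') :
    ρ u (s ((1 : G) : G ⧸ U')) = s ((1 : G) : G ⧸ U') := by
  rw [← apply_smul_of_mem_invariants ρ hU' hs, smul_mk_eq, mul_one, (QuotientGroup.eq_one_iff u).2 hu, QuotientGroup.mk_one]

/-- The values of an invariant function along the powers of `a`: `s(ā^i) = ρ(a)^i (s(1))`. [cite: SerreLocalFields1979, VII §5] -/
theorem apply_mk_pow_of_mem_invariants [U'.Normal] {s : G ⧸ U' → M} (hs : s ∈ (ρ.coindOpen U' hU').toTopRep.ρ.invariants) (a : G) (i : ℕ) :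
    s ((a : G ⧸ U') ^ i) = (fun w => ρ a w)^[i] (s ((1 : G) : G ⧸ U')) := by
  induction i with
  | zero => rw [pow_zero, Function.iterate_zero_apply, ← QuotientGroup.mk_one]
  | succ i ih =>
    rw [Function.iterate_succ_apply', ← ih, pow_succ', ← QuotientGroup.mk_pow, ← QuotientGroup.mk_mul, ← smul_mk_eq,
      apply_smul_of_mem_invariants ρ hU' hs, QuotientGroup.mk_pow]

variable [Fintype (G ⧸ U')]

omit [TopologicalSpace G] [IsTopologicalGroup G] [CompactSpace G] in
/-- **The fibre of `G ⧸ U' → G ⧸ U` over the unit coset is `{ā^j : j < p^e}`** when the fibres are `⟨ā⟩`-orbits (`hgenU`) and `ā` has order `p^e` in `G ⧸ U'`.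
[cite: NeukirchSchmidtWingberg2008, I §5] [cite: Washington1997, §13.1] -/
theorem filter_quotientMapOfLE_eq_one_eq_image [U'.Normal] {p e : ℕ} {a : G} (haU : a ∈ U) (hord : orderOf (a : G ⧸ U') = p ^ e)
    (hpe : 0 < p ^ e)
    (hgenU : ∀ z z' : G ⧸ U', Subgroup.quotientMapOfLE hU'U z = Subgroup.quotientMapOfLE hU'U z' → ∃ j : ℕ, z' = z * (a : G ⧸ U') ^ j) :
    (Finset.univ.filter fun z : G ⧸ U' => Subgroup.quotientMapOfLE hU'U z = ((1 : G) : G ⧸ U)) =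
      (Finset.range (p ^ e)).image fun j => (a : G ⧸ U') ^ j := by
  ext z
  simp only [Finset.mem_filter, Finset.mem_univ, true_and, Finset.mem_image, Finset.mem_range]
  constructor
  · intro hz
    have h1 : Subgroup.quotientMapOfLE hU'U ((1 : G) : G ⧸ U') = Subgroup.quotientMapOfLE hU'U z := by
      rw [hz, Subgroup.quotientMapOfLE_apply_mk]
    obtain ⟨j, hj⟩ := hgenU _ _ h1
    refine ⟨j % p ^ e, Nat.mod_lt _ hpe, ?_⟩
    rw [hj, QuotientGroup.mk_one, one_mul, ← hord, pow_mod_orderOf]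
  · rintro ⟨j, -, rfl⟩
    rw [← QuotientGroup.mk_pow, Subgroup.quotientMapOfLE_apply_mk, QuotientGroup.eq]
    simpa using U.pow_mem haU j

include hU in
/-- ★ **THE `H⁰`-NORM VANISHES** `Maps(G ⧸ U', M)^G —Σ_{U'→U}→ Maps(G ⧸ U, M)` on FINITE `p^k`-torsion coefficients along a cyclic fibre `⟨ā⟩` of order `p^e`,
`e ≥ t + k`, `#M ≤ p^t`: the norm of `v = s(1) ∈ M^{U'}` is the orbit sum `Σ_{i<p^e} ρ(a)^i v = 0` (`sum_range_iterate_eq_zero`), and an invariant function vanishing at the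
unit coset vanishes. Hypothesis `hH0` of `exists_coindFinRes_eq_coindFinSum_of_rTransHom_eq`; in the `ℤ_p²`-tower `U' = Gal(K̄/K^{(1)}_{m'})`, `U = Gal(K̄/K^{(1)}_m)`,
`a = γ₁^{p^m}`, `e = m' − m`. [cite: PerrinRiou1994Invent, §1.3] [cite: Washington1997, §13.3] [cite: NeukirchSchmidtWingberg2008, I §6 Prop. (1.6.4)] -/
theorem coindFinSum_eq_zero_of_mem_invariants [U'.Normal] [Finite M] {p k t e : ℕ} (hp : p.Prime) (htor : ∀ x : M, p ^ k • x = 0)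
    (hM : Nat.card M ≤ p ^ t) (he : t + k ≤ e) {a : G} (haU : a ∈ U) (hord : orderOf (a : G ⧸ U') = p ^ e)
    (hgenU : ∀ z z' : G ⧸ U', Subgroup.quotientMapOfLE hU'U z = Subgroup.quotientMapOfLE hU'U z' → ∃ j : ℕ, z' = z * (a : G ⧸ U') ^ j)
    (s : G ⧸ U' → M) (hs : s ∈ (ρ.coindOpen U' hU').toTopRep.ρ.invariants) :
    (coindFinSum ρ.toTopRep hU'U).hom s = 0 := by
  have hpe : 0 < p ^ e := pow_pos hp.pos e
  -- the value at the unit coset is the orbit sum of `v = s(1)` under `ρ(a)`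
  have hone : (coindFinSum ρ.toTopRep hU'U).hom s ((1 : G) : G ⧸ U) = 0 := by
    rw [coindFinSum_apply, ← Finset.sum_filter, filter_quotientMapOfLE_eq_one_eq_image hU'U haU hord hpe hgenU,
      Finset.sum_image fun i hi j hj hij => (pow_injOn_Iio_orderOf (x := (a : G ⧸ U'))
        (by rw [Set.mem_Iio, hord]; exact Finset.mem_range.1 hi) (by rw [Set.mem_Iio, hord]; exact Finset.mem_range.1 hj) hij)]
    simp only [apply_mk_pow_of_mem_invariants ρ hU' hs]
    refine sum_range_iterate_eq_zero hp htor hM he _ _ ?_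
    -- periodicity: `ρ(a)^{p^e} v = ρ(a^{p^e}) v = v` as `a^{p^e} ∈ U'`
    have hae : a ^ p ^ e ∈ U' := by
      rw [← QuotientGroup.eq_one_iff, QuotientGroup.mk_pow, ← hord, pow_orderOf_eq_one]
    change (fun w => ρ a w)^[p ^ e] (s ((1 : G) : G ⧸ U')) = s ((1 : G) : G ⧸ U')
    rw [← apply_mk_pow_of_mem_invariants ρ hU' hs, ← QuotientGroup.mk_pow, ← mul_one (a ^ p ^ e), ← smul_mk_eq,
      apply_smul_of_mem_invariants ρ hU' hs, apply_one_mem_of_mem_invariants ρ hU' hs hae]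
  -- an invariant function on `G ⧸ U` vanishing at the unit coset vanishes
  have hinv : (coindFinSum ρ.toTopRep hU'U).hom s ∈ (ρ.coindOpen U hU).toTopRep.ρ.invariants := fun g => by
    change (coindFin.{0, u} ρ.toTopRep U).ρ g ((coindFinSum ρ.toTopRep hU'U).hom s) = (coindFinSum ρ.toTopRep hU'U).hom s
    rw [← TopRep.hom_comm_apply]
    exact congrArg _ ((ContRepresentation.mem_invariants _).1 hs g)
  funext x
  induction x using QuotientGroup.induction_on with
  | H g =>
    have h := apply_smul_of_mem_invariants ρ hU hinv g ((1 : G) : G ⧸ U)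
    rw [smul_mk_eq, mul_one] at h
    rw [h, hone, map_zero]
    rfl

end HZero

end Summit.BirchSwinnertonDyer.BirchSwinnertonDyer.Theorems.SmallImageRttD2TF

end
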